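import Summits.Ventures.PercRepro.C025ProfileThinRowC

/-!
# THE ROW `(q, q+1)` IN THE THIN REGIME WITH GIRTH: `q < g(g−1)` (night-3 g13)
`proofs/NIGHT3-G13-LIFT.md` §4b. The bound `q ≤ 5` of THEOREM T(q) came from the circuit size `k ≥ 3` of a simple matroid in the
capacity count `c (2q + 3 − c) ≤ (q+1)²` for `c ≤ q + 2 − k` coloops. With GIRTH `≥ g` (every set of fewer than `g` elements is
independent; `g ≥ 3` is simplicity) a rank-`(q+1)` set with `q + 2` points has at least `g` non-coloops (`card_col_add_girth_le`), and the
count holds exactly when `q + 1 + g ≤ g²`, i.e. `q < g(g − 1)` (`arith_thin_girth`: `(q+1)² − c(2q+3−c) = (g² − g − (q+1)) + d(2g + d − 1)` at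
`c = q + 2 − g − d`). Hence **THEOREM T(q, g)**: `profileIneq_succ_of_thin_girth` — the row `(q, q+1)` of C-032 (and its Hall form) for
every finite matroid of girth `≥ g ≥ 3` in which every rank-`q` set has at most `q + 1` points, whenever `q + 1 + g ≤ g²`. At `g = 3`
this is T(q ≤ 5); at `g ≥ q + 2` (the tree's girth regime `profileIneq_of_girth`) the arithmetic is automatic and thinness is implied.
-/
open scoped Matroid
namespace PercRepro
open Set Finset ThmH Staged
namespace ThinRow
variable {α : Type} [DecidableEq α] {M : Matroid α} [M.Finite]

/-- **The capacity arithmetic with girth**: for `c + g ≤ q + 2` and `q + 1 + g ≤ g²`, `c (q + 1) + c (q + 2 − c) ≤ (q + 1)²`. -/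
theorem arith_girth_key {q c g : ℕ} (hg1 : 1 ≤ g) (hc : c + g ≤ q + 2) (hq : q + 1 + g ≤ g * g) :
    c * (q + 1) + c * (q + 2 - c) ≤ (q + 1) * (q + 1) := by
  obtain ⟨d, hd⟩ : ∃ d, c + g + d = q + 2 := ⟨q + 2 - (c + g), by omega⟩
  have hcq : c ≤ q + 2 := by omega
  have hcast : ((q + 2 - c : ℕ) : ℤ) = (q : ℤ) + 2 - c := by rw [Nat.cast_sub hcq]; push_cast; ring
  have h1 : ((c * (q + 1) + c * (q + 2 - c) : ℕ) : ℤ) ≤ (((q + 1) * (q + 1) : ℕ) : ℤ) := by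
    push_cast
    rw [hcast]
    have hd' : (c : ℤ) = (q : ℤ) + 2 - g - d := by
      have : ((c + g + d : ℕ) : ℤ) = ((q + 2 : ℕ) : ℤ) := by rw [hd]
      push_cast at this; linarith
    have hq' : (q : ℤ) + 1 + g ≤ (g : ℤ) * g := by exact_mod_cast hq
    have hg1' : (1 : ℤ) ≤ g := by exact_mod_cast hg1
    have hd0 : (0 : ℤ) ≤ d := by exact_mod_cast Nat.zero_le d
    have key : (c : ℤ) * (q + 1) + c * (q + 2 - c) + ((g : ℤ) * g - g - (q + 1)) + d * (2 * g + d - 1) =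
        ((q : ℤ) + 1) * (q + 1) := by
      rw [hd']; ring
    have hA : (0 : ℤ) ≤ (g : ℤ) * g - g - (q + 1) := by linarith
    have hB : (0 : ℤ) ≤ (d : ℤ) * (2 * g + d - 1) := mul_nonneg hd0 (by linarith)
    linarith
  exact_mod_cast h1

/-- The thin-regime arithmetic with girth `g` (`g ≥ 3`, `q + 1 + g ≤ g²`): `a + b/(m+1) ≤ q + 1`. -/
theorem arith_thin_girth {q c a b m g : ℕ} (hg3 : 3 ≤ g) (hq : q + 1 + g ≤ g * g) (hc : c + g ≤ q + 2) (ha : a ≤ c)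
    (hb : b ≤ c * (q + 2 - c)) (ha' : 1 ≤ a → q + 1 ≤ m + 1) (hb' : 1 ≤ b → q ≤ m + 1) :
    (a : ℚ) + (b : ℚ) / ((m : ℚ) + 1) ≤ (q : ℚ) + 1 := by
  have hm : (0 : ℚ) < (m : ℚ) + 1 := by positivity
  have hcq : c ≤ q + 2 := by omega
  have hcast : ((q + 2 - c : ℕ) : ℚ) = (q : ℚ) + 2 - c := by rw [Nat.cast_sub hcq]; push_cast; ring
  rcases Nat.eq_zero_or_pos a with ha0 | ha1
  · subst ha0
    rcases Nat.eq_zero_or_pos b with hb0 | hb1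
    · subst hb0
      simp only [Nat.cast_zero, zero_add, zero_div]
      positivity
    · have hqm := hb' hb1
      -- `c (q + 2 − c) ≤ q (q + 1)`: from `c ≤ q − 1` (`g ≥ 3`) when `q ≥ 1`; `c = 0` when `q = 0`
      have key : b ≤ q * (q + 1) := by
        rcases Nat.eq_zero_or_pos c with hc0 | hc1
        · subst hc0; simp at hb; omega
        · have h1 : c ≤ q := by omega
          have h3 : q + 2 - c ≤ q + 1 := by omega
          exact hb.trans (Nat.mul_le_mul h1 h3)
      have h1 : (b : ℚ) ≤ (q : ℚ) * ((q : ℚ) + 1) := by exact_mod_cast key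
      have h2 : (q : ℚ) ≤ (m : ℚ) + 1 := by exact_mod_cast hqm
      have h3 : (0 : ℚ) ≤ q := by positivity
      rw [Nat.cast_zero, zero_add, div_le_iff₀ hm]
      nlinarith
  · have hqm := ha' ha1
    have key := arith_girth_key (by omega : 1 ≤ g) hc hq
    have hq1 : (0 : ℚ) < (q : ℚ) + 1 := by positivity
    have hle : ((q : ℚ) + 1) ≤ (m : ℚ) + 1 := by exact_mod_cast hqm
    have h1 : (b : ℚ) / ((m : ℚ) + 1) ≤ (b : ℚ) / ((q : ℚ) + 1) :=
      div_le_div_of_nonneg_left (by positivity) hq1 hle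
    have h2 : (b : ℚ) ≤ (c : ℚ) * ((q : ℚ) + 2 - c) := by
      have : (b : ℚ) ≤ ((c * (q + 2 - c) : ℕ) : ℚ) := by exact_mod_cast hb
      rw [Nat.cast_mul, hcast] at this
      exact this
    have h3 : (a : ℚ) ≤ c := by exact_mod_cast ha
    have key' : (c : ℚ) * ((q : ℚ) + 1) + (c : ℚ) * ((q : ℚ) + 2 - c) ≤ ((q : ℚ) + 1) * ((q : ℚ) + 1) := by
      have : ((c * (q + 1) + c * (q + 2 - c) : ℕ) : ℚ) ≤ (((q + 1) * (q + 1) : ℕ) : ℚ) := by exact_mod_cast key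
      rw [Nat.cast_add, Nat.cast_mul, Nat.cast_mul, hcast] at this
      push_cast at this
      linarith
    have h4 : (b : ℚ) / ((q : ℚ) + 1) ≤ (c : ℚ) * ((q : ℚ) + 2 - c) / ((q : ℚ) + 1) :=
      div_le_div_of_nonneg_right h2 hq1.le
    have h5 : (c : ℚ) * ((q : ℚ) + 2 - c) / ((q : ℚ) + 1) ≤ (q : ℚ) + 1 - c := by
      rw [div_le_iff₀ hq1]
      linarith
    linarith

/-- **At least `g` non-coloops**: with girth `≥ g` a rank-`(q+1)` set `S` with `q + 2` points has a circuit of size `≥ g` whose points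
are not coloops of `S`: `#col S + g ≤ |S|`. -/
theorem card_col_add_girth_le {g : ℕ} (hgirth : ∀ T ⊆ M.E, T.encard < g → M.Indep T) {q : ℕ} {S : Finset α}
    (hS : S ∈ Shadow.levelSet M (q + 1)) (hcard : S.card = q + 2) :
    (S.filter (fun x => rkN M (S.erase x) + 1 = rkN M S)).card + g ≤ S.card := by
  rw [Profile.mem_levelSet] at hS
  obtain ⟨hSg, hSr⟩ := hS
  have hSE : (S : Set α) ⊆ M.E := by rw [← coe_gr]; exact_mod_cast hSg
  have hdep : M.Dep (S : Set α) := by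
    rw [Matroid.dep_iff]
    refine ⟨fun hind => ?_, hSE⟩
    have h1 := hind.eRk_eq_encard
    rw [hSr, Set.encard_coe_eq_coe_finsetCard, hcard] at h1
    have h2 : q + 1 = q + 2 := by exact_mod_cast h1
    omega
  obtain ⟨C, hCS, hC⟩ := hdep.exists_isCircuit_subset
  have hCg : (g : ℕ∞) ≤ C.encard := by
    by_contra h
    push Not at h
    exact hC.dep.not_indep (hgirth C hC.subset_ground h)
  have hCfin : C.Finite := S.finite_toSet.subset hCS
  set Cf := hCfin.toFinset with hCf
  have hCfcard : g ≤ Cf.card := by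
    have h1 : ((Cf : Set α)).encard = Cf.card := Set.encard_coe_eq_coe_finsetCard Cf
    rw [hCf, Set.Finite.coe_toFinset] at h1
    rw [h1] at hCg
    exact_mod_cast hCg
  have hCfcol : Cf ⊆ S \ S.filter (fun x => rkN M (S.erase x) + 1 = rkN M S) := by
    intro y hy
    have hyC : y ∈ C := by rw [hCf, Set.Finite.mem_toFinset] at hy; exact hy
    have hyS : y ∈ S := hCS hyC
    rw [Finset.mem_sdiff, Finset.mem_filter]
    refine ⟨hyS, fun hcol => ?_⟩
    have hycl : y ∈ clF M (S.erase y) := by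
      have h1 : y ∈ M.closure (C \ {y}) := hC.mem_closure_sdiff_singleton_of_mem hyC
      have h2 : C \ {y} ⊆ ((S.erase y : Finset α) : Set α) := by
        rw [Finset.coe_erase]
        exact Set.sdiff_subset_sdiff_left hCS
      have h3 : y ∈ M.closure ((S.erase y : Finset α) : Set α) := M.closure_subset_closure h2 h1
      rw [← coe_clF] at h3
      exact_mod_cast h3
    have h4 := rkN_erase_eq_of_mem_clF_erase hSg hycl
    omega
  have h5 : Cf.card ≤ (S \ S.filter (fun x => rkN M (S.erase x) + 1 = rkN M S)).card := Finset.card_le_card hCfcol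
  rw [Finset.card_sdiff_of_subset (Finset.filter_subset _ _)] at h5
  have h6 : (S.filter (fun x => rkN M (S.erase x) + 1 = rkN M S)).card ≤ S.card :=
    Finset.card_le_card (Finset.filter_subset _ _)
  omega

/-- **(Cap) with girth**: for `g ≥ 3` and `q + 1 + g ≤ g²`, every rank-`(q+1)` set of a thin matroid of girth `≥ g` carries load `≤ 1`. -/
theorem cap_thin_girth (q g : ℕ) (hg3 : 3 ≤ g) (hq : q + 1 + g ≤ g * g)
    (hgirth : ∀ T ⊆ M.E, T.encard < g → M.Indep T)
    (hthin : ∀ X ⊆ gr M, rkN M X = q → X.card ≤ q + 1) {S : Finset α} (hS : S ∈ Shadow.levelSet M (q + 1)) :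
    ∑ B ∈ (Profile.Rq M q).filter (fun B => B ⊆ S),
      ((if q + 1 ≤ crk M B ∧ ∃ x ∈ outer M B, S = insert x B then (1 : ℚ) else 0) +
        (if q + 1 ≤ crk M B ∧ crk M B = (outer M B).card + 1 ∧ ∃ x ∈ outer M B, S = insert x (clF M B) then
          1 / ((outer M B).card : ℚ) else 0)) / ((q : ℚ) + 1) ≤ 1 := by
  rw [← Finset.sum_div, div_le_one (by positivity), Finset.sum_add_distrib]
  have h1 := sum_w1_le_card_D1 (M := M) q (S := S)
  have h2 := sum_w2_le_card_D2 q hthin hS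
  set D1 := S.filter (fun x => S.erase x ∈ Profile.Rq M q ∧ q + 1 ≤ crk M (S.erase x) ∧ x ∈ outer M (S.erase x))
    with hD1
  set D2 := (S ×ˢ S).filter (fun xy => xy.1 ≠ xy.2 ∧ (S.erase xy.1).erase xy.2 ∈ Profile.Rq M q ∧
      q + 1 ≤ crk M ((S.erase xy.1).erase xy.2) ∧
      crk M ((S.erase xy.1).erase xy.2) = (outer M ((S.erase xy.1).erase xy.2)).card + 1 ∧
      xy.1 ∈ outer M ((S.erase xy.1).erase xy.2) ∧ S = insert xy.1 (clF M ((S.erase xy.1).erase xy.2))) with hD2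
  set col := S.filter (fun x => rkN M (S.erase x) + 1 = rkN M S) with hcol
  set m := (gr M \ S).card with hm
  have hD1col : D1 ⊆ col := D1_subset_col hS
  have hD2sub : D2 ⊆ col ×ˢ (S \ col) := by
    intro xy hxy
    have hf := mem_D2_facts hthin hS hxy
    have hxy' := Finset.mem_product.mp (Finset.mem_filter.mp hxy).1
    rw [Finset.mem_product, Finset.mem_sdiff]
    exact ⟨Finset.mem_filter.mpr ⟨hxy'.1, hf.2.2.2.2.1⟩, hxy'.2,
      fun h => hf.2.2.2.2.2 (Finset.mem_filter.mp h).2⟩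
  have hSq : rkN M S = q + 1 := rkN_eq_iff.mpr (Profile.mem_levelSet.mp hS).2
  have hScard_ge : q + 1 ≤ S.card := hSq ▸ rkN_le_card S
  have key : (D1.card : ℚ) + (D2.card : ℚ) / ((m : ℚ) + 1) ≤ (q : ℚ) + 1 := by
    rcases Nat.lt_or_ge S.card (q + 2) with hlt | hge
    · have hD2e : D2 = ∅ := by
        rw [Finset.eq_empty_iff_forall_notMem]
        intro xy hxy
        have := (mem_D2_facts hthin hS hxy).2.2.1
        omega
      have hD1c : D1.card ≤ q + 1 := (Finset.card_le_card (Finset.filter_subset _ _)).trans (by omega)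
      rw [hD2e, Finset.card_empty, Nat.cast_zero, zero_div, add_zero]
      exact_mod_cast hD1c
    rcases Nat.lt_or_ge S.card (q + 3) with hlt2 | hge2
    · have hScard : S.card = q + 2 := by omega
      have hc := card_col_add_girth_le hgirth hS hScard
      rw [hScard] at hc
      have ha : D1.card ≤ col.card := Finset.card_le_card hD1col
      have hb : D2.card ≤ col.card * (q + 2 - col.card) := by
        have := Finset.card_le_card hD2sub
        rw [Finset.card_product, Finset.card_sdiff_of_subset (Finset.filter_subset _ _), hScard] at this
        exact this
      have ha' : 1 ≤ D1.card → q + 1 ≤ m + 1 := by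
        intro h
        obtain ⟨x, hx⟩ := Finset.card_pos.mp h
        exact (card_of_mem_D1 hthin hS hx).2
      have hb' : 1 ≤ D2.card → q ≤ m + 1 := by
        intro h
        obtain ⟨xy, hxy⟩ := Finset.card_pos.mp h
        exact (mem_D2_facts hthin hS hxy).2.2.2.1
      exact arith_thin_girth hg3 hq hc ha hb ha' hb'
    · have hD1e : D1 = ∅ := by
        rw [Finset.eq_empty_iff_forall_notMem]
        intro x hx
        have := (card_of_mem_D1 hthin hS hx).1
        omega
      have hD2e : D2 = ∅ := by
        rw [Finset.eq_empty_iff_forall_notMem]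
        intro xy hxy
        have := (mem_D2_facts hthin hS hxy).2.2.1
        omega
      rw [hD1e, hD2e, Finset.card_empty, Finset.card_empty, Nat.cast_zero, zero_div, add_zero]
      positivity
  linarith

/-- **THEOREM T(q, g)**: the row `(q, q+1)` of (Π) for every finite matroid of girth `≥ g ≥ 3` whose rank-`q` sets have at most `q + 1`
points, whenever `q + 1 + g ≤ g²` (`g = 3`: `q ≤ 5`; `g = 4`: `q ≤ 11`; `g = 5`: `q ≤ 19`; `g ≥ q + 2`: always). -/
theorem profileIneq_succ_of_thin_girth (q g : ℕ) (hg3 : 3 ≤ g) (hq : q + 1 + g ≤ g * g)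
    (hgirth : ∀ T ⊆ M.E, T.encard < g → M.Indep T)
    (hthin : ∀ X ⊆ gr M, rkN M X = q → X.card ≤ q + 1) : Profile.ProfileIneq M q (q + 1) :=
  profileIneq_of_cert q (q + 1)
    (fun B S => ((if q + 1 ≤ crk M B ∧ ∃ x ∈ outer M B, S = insert x B then (1 : ℚ) else 0) +
        (if q + 1 ≤ crk M B ∧ crk M B = (outer M B).card + 1 ∧ ∃ x ∈ outer M B, S = insert x (clF M B) then
          1 / ((outer M B).card : ℚ) else 0)) / ((q : ℚ) + 1))
    (fun _ hS => cap_thin_girth q g hg3 hq hgirth hthin hS) (fun _ hB => dem_thin q hthin hB)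

/-- **THEOREM T(q, g), Hall form (C-033).** -/
theorem hallIneq_succ_of_thin_girth (q g : ℕ) (hg3 : 3 ≤ g) (hq : q + 1 + g ≤ g * g)
    (hgirth : ∀ T ⊆ M.E, T.encard < g → M.Indep T)
    (hthin : ∀ X ⊆ gr M, rkN M X = q → X.card ≤ q + 1) : Profile.HallIneq M q (q + 1) :=
  hallIneq_of_cert q (q + 1)
    (fun B S => ((if q + 1 ≤ crk M B ∧ ∃ x ∈ outer M B, S = insert x B then (1 : ℚ) else 0) +
        (if q + 1 ≤ crk M B ∧ crk M B = (outer M B).card + 1 ∧ ∃ x ∈ outer M B, S = insert x (clF M B) then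
          1 / ((outer M B).card : ℚ) else 0)) / ((q : ℚ) + 1))
    (fun B S => wThin_nonneg q B S) (fun _ hS => cap_thin_girth q g hg3 hq hgirth hthin hS)
    (fun _ hB => dem_thin q hthin hB)

/-- Simplicity is girth `≥ 3`; T(q ≤ 5) is the case `g = 3` of T(q, g). -/
theorem profileIneq_succ_of_thin' (q : ℕ) (hq : q ≤ 5) (hsimple : ∀ T ⊆ M.E, T.encard ≤ 2 → M.Indep T)
    (hthin : ∀ X ⊆ gr M, rkN M X = q → X.card ≤ q + 1) : Profile.ProfileIneq M q (q + 1) :=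
  profileIneq_succ_of_thin_girth q 3 le_rfl (by omega)
    (fun T hT h => hsimple T hT ((ENat.lt_add_one_iff (by norm_num)).mp (by norm_num at h ⊢; exact h))) hthin

omit [DecidableEq α] in
/-- Girth `≥ q + 2` forces thinness at rank `q`: a rank-`q` set with `≥ q + 2` points would contain an independent `(q+1)`-subset. -/
theorem thin_of_girth {q : ℕ} (hgirth : ∀ T ⊆ M.E, T.encard < ((q + 2 : ℕ) : ℕ∞) → M.Indep T) :
    ∀ X ⊆ gr M, rkN M X = q → X.card ≤ q + 1 := by
  intro X hXg hX
  by_contra hlt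
  push Not at hlt
  obtain ⟨Y, hYX, hYcard⟩ := Finset.exists_subset_card_eq (show q + 1 ≤ X.card by omega)
  have hYE : (Y : Set α) ⊆ M.E := by
    rw [← coe_gr]; exact_mod_cast hYX.trans hXg
  have hYind : M.Indep (Y : Set α) := by
    apply hgirth Y hYE
    rw [Set.encard_coe_eq_coe_finsetCard, hYcard]
    exact_mod_cast (by omega : q + 1 < q + 2)
  have h1 : rkN M Y = q + 1 := by
    rw [rkN_eq_iff, hYind.eRk_eq_encard, Set.encard_coe_eq_coe_finsetCard, hYcard]
  have h2 : rkN M Y ≤ rkN M X := rkN_mono hYX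
  omega

/-- **The tree's girth regime is the case `g = q + 2` of T(q, g)**: girth `≥ q + 2` gives the row `(q, q+1)` (cf. `profileIneq_of_girth`). -/
theorem profileIneq_succ_of_girth' (q : ℕ) (hq1 : 1 ≤ q)
    (hgirth : ∀ T ⊆ M.E, T.encard < ((q + 2 : ℕ) : ℕ∞) → M.Indep T) : Profile.ProfileIneq M q (q + 1) :=
  profileIneq_succ_of_thin_girth q (q + 2) (by omega) (by nlinarith) hgirth (thin_of_girth hgirth)

end ThinRow
end PercRepro
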